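import Mathlib
import Summits.NavierStokesRegularity.NavierStokesRegularity.Theorems.DssFarFieldSlavingBlowupTypeIDssProfileSpatioTemporal
import HarnessLib

/-!
# n15 dictionary: a spatio-temporal symmetry of a co-rotating ansatz field in similarity variables (+ E5/P2 bookkeeping)

HONEST FRAMING (pub-ns-dss theory seat g3, 2026-08-22). What this is: pure ALGEBRA supporting the census
null test n15 (HOME/theory/NULL-TESTS.md) — what the `(μ, g)`-structure (a spatio-temporal symmetry) of a
co-rotating ansatz field `pvAnsatz α W` on negative times says about the data `W(·, s)` an engine computes,
plus the data-level restatement of the landed T25 K4 theorem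
(`SpatioTemporal.corotating_spatioTemporalReversing_trivial`). What this is NOT: no claim about
Navier–Stokes regularity or blow-up; no number.

In the INERTIAL similarity frame (`U_in(s, y) = R(αs) W(R(−αs) y, s)`, the tree's `lerayOrbit` of the
ansatz field, `PineauVicol2026.lerayOrbit_pvAnsatz`) the structure is the twisted periodicity
`U_in(s + 2 log μ, y) = g⁻¹ U_in(s, g y)` with the FIXED element `g` (`lerayOrbit_add_eq_symm_iff`); in
the co-rotating frame, for a rotation-reversing `g`, the matching element DRIFTS:
`W(z, s + τ₀) = h_s⁻¹ W(h_s z, s)`, `h_s = g ∘ R(α(2s + τ₀))`, `τ₀ = 2 log μ` — so a phase-shifted match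
with ONE fixed mirror in co-rotating variables is not the symmetry unless `α = 0`. Conventions are the
tree's `pvAnsatz`: `s = −log(−t)`, `y = x/√(−t)`, frame angle `α·s`. A second section records the
three bookkeeping identities the census rows use: same factor ⇒ the quotient is spatial
(`slices_equivariant_of_same_factor`), twist modulo isotropy (`structure_comp_isotropy`), squaring a
structure (`structure_sq`; improper / finite-order twists reduce).

[cite: PineauVicol2026, (1.13a) (arXiv:2607.09619 p. 7)]
[cite: BradshawTsai2017CPDE, §1 (v-RDSS), arXiv:1610.05680 p. 3]
[cite: GolubitskyStewart2002, Ch. 6 Def. 6.14, Thm 6.26]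
-/

noncomputable section

set_option linter.dupNamespace false

namespace Summit.NavierStokesRegularity.NavierStokesRegularity.Theorems.SpatioTemporal

open MeasureTheory Set Function Filter Metric
open Literature.Analysis.FluidPDE
open Summit.NavierStokesRegularity.NavierStokesRegularity.Theorems
open scoped Topology


/-! ### n15 dictionary: a spatio-temporal symmetry in similarity variables (inertial vs co-rotating)

Pure algebra, no Navier–Stokes: what the `(μ, g)`-structure of a co-rotating ansatz field
`pvAnsatz α W` on negative times says about the data `W(·, s)` an engine actually computes. In the
INERTIAL similarity frame (`U_in(s, y) = R(αs) W(R(−αs) y, s)`, the tree's `lerayOrbit`) it is the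
twisted periodicity `U_in(s + 2 log μ, y) = g⁻¹ U_in(s, g y)` with the FIXED element `g`; in the
co-rotating frame, for a rotation-reversing `g`, the matching element DRIFTS:
`W(z, s + τ₀) = h_s⁻¹ W(h_s z, s)`, `h_s = g ∘ R(α(2s + τ₀))`, `τ₀ = 2 log μ`. (NULL-TESTS n15.) -/

/-- **Inertial similarity frame.** For `μ > 0` and any linear isometry `g`, the `(μ, g)`-structure of
`pvAnsatz α W` on negative times is equivalent to `U_in(s + 2 log μ, y) = g⁻¹ U_in(s, g y)` for the
inertial similarity profile `U_in(s, y) = R(αs) W(R(−αs) y, s)` (tree: `lerayOrbit_add_eq_symm_iff`,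
`lerayOrbit_pvAnsatz`). [folklore] -/
theorem pvAnsatz_structure_iff_inertial (α : ℝ) (W : (EuclideanSpace ℝ (Fin 3)) → ℝ → (EuclideanSpace ℝ (Fin 3))) {μ : ℝ} (hμ : 0 < μ)
    (g : (EuclideanSpace ℝ (Fin 3)) ≃ₗᵢ[ℝ] (EuclideanSpace ℝ (Fin 3))) :
    (∀ t < 0, ∀ x, μ • g.symm (pvAnsatz α W (μ ^ 2 * t) (μ • g x)) = pvAnsatz α W t x) ↔
    ∀ s y, rotZ (α * (s + 2 * Real.log μ))
        (W (rotZ (-(α * (s + 2 * Real.log μ))) y) (s + 2 * Real.log μ)) =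
      g.symm (rotZ (α * s) (W (rotZ (-(α * s)) (g y)) s)) := by
  rw [← lerayOrbit_add_eq_symm_iff hμ]
  simp only [PineauVicol2026.lerayOrbit_pvAnsatz]

/-- A rotation-reversing isometry has a rotation-reversing inverse. [folklore] -/
theorem reverses_symm {g : (EuclideanSpace ℝ (Fin 3)) ≃ₗᵢ[ℝ] (EuclideanSpace ℝ (Fin 3))} (hg : ∀ φ y, g (rotZ φ y) = rotZ (-φ) (g y))
    (φ : ℝ) (y : (EuclideanSpace ℝ (Fin 3))) : g.symm (rotZ φ y) = rotZ (-φ) (g.symm y) := by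
  apply g.injective
  rw [LinearIsometryEquiv.apply_symm_apply, hg, neg_neg, LinearIsometryEquiv.apply_symm_apply]

/-- **Co-rotating frame (the K4 data).** For a rotation-reversing `g` and `μ > 0`, the
`(μ, g)`-structure of `pvAnsatz α W` on negative times is equivalent to the DRIFTING-MIRROR identity on
the co-rotating profile: `W(z, s + τ₀) = R(−α(2s + τ₀)) g⁻¹ W(g R(α(2s + τ₀)) z, s)`, `τ₀ = 2 log μ` —
i.e. `W(·, s + τ₀) = h_s⁻¹ W(h_s ·, s)` with `h_s = g ∘ R(α(2s + τ₀))`, a reversing element whose mirror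
rotates at rate `−α` in the co-rotating frame (it is fixed in the inertial one). A phase-shifted match
with ONE fixed mirror for all `s` in co-rotating variables is therefore NOT the spatio-temporal symmetry
unless `α = 0`. [folklore] -/
theorem pvAnsatz_structure_iff_corotating (α : ℝ) (W : (EuclideanSpace ℝ (Fin 3)) → ℝ → (EuclideanSpace ℝ (Fin 3))) {μ : ℝ} (hμ : 0 < μ)
    {g : (EuclideanSpace ℝ (Fin 3)) ≃ₗᵢ[ℝ] (EuclideanSpace ℝ (Fin 3))} (hg : ∀ φ y, g (rotZ φ y) = rotZ (-φ) (g y)) :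
    (∀ t < 0, ∀ x, μ • g.symm (pvAnsatz α W (μ ^ 2 * t) (μ • g x)) = pvAnsatz α W t x) ↔
    ∀ s z, W z (s + 2 * Real.log μ) =
      rotZ (-(α * (2 * s + 2 * Real.log μ)))
        (g.symm (W (g (rotZ (α * (2 * s + 2 * Real.log μ)) z)) s)) := by
  rw [pvAnsatz_structure_iff_inertial α W hμ g]
  set τ : ℝ := 2 * Real.log μ with hτ
  have hB : ∀ s : ℝ, -(α * s) + -(α * (s + τ)) = -(α * (2 * s + τ)) := fun s => by ring
  constructor
  · intro h s z
    have k1 : g (rotZ (α * (s + τ)) z) = rotZ (-(α * (s + τ))) (g z) := hg _ _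
    have k2 : g (rotZ (α * (2 * s + τ)) z) = rotZ (-(α * (2 * s + τ))) (g z) := hg _ _
    have e := h s (rotZ (α * (s + τ)) z)
    rw [← rotZ_add, neg_add_cancel, rotZ_zero, k1, ← rotZ_add] at e
    have e2 := congrArg (rotZ (-(α * (s + τ)))) e
    rw [← rotZ_add, neg_add_cancel, rotZ_zero] at e2
    rw [e2, k2, reverses_symm hg, ← rotZ_add]
    have hA : -(α * (s + τ)) + -(α * s) = -(α * (2 * s + τ)) := by ring
    rw [hA, hB]
  · intro h s y
    have k2 : ∀ z : (EuclideanSpace ℝ (Fin 3)), g (rotZ (α * (2 * s + τ)) z) = rotZ (-(α * (2 * s + τ))) (g z) :=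
      fun z => hg _ _
    set z : (EuclideanSpace ℝ (Fin 3)) := rotZ (-(α * (s + τ))) y with hz
    have hy : y = rotZ (α * (s + τ)) z := by rw [hz, ← rotZ_add, add_neg_cancel, rotZ_zero]
    have k1 : g y = rotZ (-(α * (s + τ))) (g z) := by rw [hy]; exact hg _ _
    rw [h s z, k2, ← rotZ_add, k1, ← rotZ_add, reverses_symm hg]
    have hC : α * (s + τ) + -(α * (2 * s + τ)) = -(α * s) := by ring
    rw [hC, hB]

/-- **T25 for K4 in co-rotating data (NULL-TESTS n15).** A `2 log c`-periodic co-rotating profile `W`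
whose ansatz field is Type-I ancient mild with Type-I decay, and which satisfies the drifting-mirror
identity of `pvAnsatz_structure_iff_corotating` for some `μ > 0` and a rotation-reversing `g`,
vanishes identically when `α · 2 log c / π ∉ ℚ`. -/
theorem corotating_driftingMirror_trivial {C₀ α c μ : ℝ} (hc : 1 < c) (hμ : 0 < μ)
    (hirr : Irrational (α * (2 * Real.log c) / Real.pi))
    {g : (EuclideanSpace ℝ (Fin 3)) ≃ₗᵢ[ℝ] (EuclideanSpace ℝ (Fin 3))} (hg : ∀ φ y, g (rotZ φ y) = rotZ (-φ) (g y)) {V : ℝ → (EuclideanSpace ℝ (Fin 3)) → (EuclideanSpace ℝ (Fin 3))}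
    (hV : IsTypeIAncientMild C₀ V) (hdec : HasTypeIDecay C₀ V)
    {W : (EuclideanSpace ℝ (Fin 3)) → ℝ → (EuclideanSpace ℝ (Fin 3))} (hper : ∀ (y : (EuclideanSpace ℝ (Fin 3))) (s : ℝ), W y (s + 2 * Real.log c) = W y s)
    (hans : ∀ t < 0, ∀ x, V t x = pvAnsatz α W t x)
    (hdrift : ∀ s z, W z (s + 2 * Real.log μ) =
      rotZ (-(α * (2 * s + 2 * Real.log μ)))
        (g.symm (W (g (rotZ (α * (2 * s + 2 * Real.log μ)) z)) s))) :
    W = 0 := by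
  refine corotating_spatioTemporalReversing_trivial hc hμ hirr hg hV hdec hper hans ?_
  intro t ht x
  have hμt : μ ^ 2 * t < 0 := mul_neg_of_pos_of_neg (by positivity) ht
  rw [hans t ht, hans _ hμt]
  exact (pvAnsatz_structure_iff_corotating α W hμ hg).2 hdrift t ht x


/-! ### E5 / P2 bookkeeping: same factor, twist modulo isotropy, squaring a structure

Three one-line algebraic facts the census rows use (EMPTY-CELLS E5, PHASE2-COMMENTS P2), stated with the
structures restricted to negative times. -/

/-- **Same factor ⇒ the quotient is a SPATIAL symmetry (E5).** Two rotated-DSS structures `(μ, A)` and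
`(μ, B)` with the same factor make every slice `A B⁻¹`-equivariant. (For an RSS field, which carries
`(μ, R(−2α log μ))` for every `μ`, a spatio-temporal symmetry `(μ, g)` is therefore the spatial symmetry
`R(−2α log μ) g⁻¹`.) [folklore] -/
theorem slices_equivariant_of_same_factor {μ : ℝ} (hμ : 0 < μ) {A B : (EuclideanSpace ℝ (Fin 3)) ≃ₗᵢ[ℝ] (EuclideanSpace ℝ (Fin 3))}
    {V : ℝ → (EuclideanSpace ℝ (Fin 3)) → (EuclideanSpace ℝ (Fin 3))}
    (hA : ∀ t < 0, ∀ x, μ • A.symm (V (μ ^ 2 * t) (μ • A x)) = V t x)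
    (hB : ∀ t < 0, ∀ x, μ • B.symm (V (μ ^ 2 * t) (μ • B x)) = V t x) :
    ∀ t < 0, ∀ x, V t (A (B.symm x)) = A (B.symm (V t x)) := by
  intro t ht x
  have ht₀ : t / μ ^ 2 < 0 := div_neg_of_neg_of_pos ht (by positivity)
  have hμt : μ ^ 2 * (t / μ ^ 2) = t := by field_simp
  have e1 := hA (t / μ ^ 2) ht₀ (μ⁻¹ • B.symm x)
  have e2 := hB (t / μ ^ 2) ht₀ (μ⁻¹ • B.symm x)
  rw [hμt, map_smul, smul_smul, mul_inv_cancel₀ hμ.ne', one_smul] at e1 e2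
  rw [LinearIsometryEquiv.apply_symm_apply] at e2
  have e3 : A.symm (V t (A (B.symm x))) = B.symm (V t x) :=
    smul_right_injective (EuclideanSpace ℝ (Fin 3)) hμ.ne' (e1.trans e2.symm)
  calc V t (A (B.symm x)) = A (A.symm (V t (A (B.symm x)))) := by
        rw [LinearIsometryEquiv.apply_symm_apply]
    _ = A (B.symm (V t x)) := by rw [e3]

/-- **Twist modulo isotropy (P2).** If `V` is `(c, R)`-RDSS on negative times and `g` is a spatial symmetry
of every negative-time slice, then `V` is also `(c, R ∘ g)`-RDSS: the twist of a census row is a coset of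
the state's isotropy group, to be recorded in normal form. [folklore] -/
theorem structure_comp_isotropy {c : ℝ} {R g : (EuclideanSpace ℝ (Fin 3)) ≃ₗᵢ[ℝ] (EuclideanSpace ℝ (Fin 3))} {V : ℝ → (EuclideanSpace ℝ (Fin 3)) → (EuclideanSpace ℝ (Fin 3))}
    (hR : ∀ t < 0, ∀ x, c • R.symm (V (c ^ 2 * t) (c • R x)) = V t x)
    (hg : ∀ t < 0, ∀ x, V t (g x) = g (V t x)) :
    ∀ t < 0, ∀ x, c • (g.trans R).symm (V (c ^ 2 * t) (c • (g.trans R) x)) = V t x := by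
  intro t ht x
  have key := hR t ht (g x)
  rw [hg t ht x] at key
  calc c • (g.trans R).symm (V (c ^ 2 * t) (c • (g.trans R) x))
      = c • g.symm (R.symm (V (c ^ 2 * t) (c • R (g x)))) := rfl
    _ = g.symm (c • R.symm (V (c ^ 2 * t) (c • R (g x)))) := by rw [map_smul]
    _ = g.symm (g (V t x)) := by rw [key]
    _ = V t x := g.symm_apply_apply _

/-- **Squaring a structure (E5: improper and finite-order twists reduce).** A `(c, S)`-structure on negative
times gives the `(c², S²)`-structure; e.g. an improper twist `S = σ_h R(θ)` yields the proper twist `R(2θ)`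
with factor `c²`. [folklore] -/
theorem structure_sq {c : ℝ} (hc : 0 < c) {S : (EuclideanSpace ℝ (Fin 3)) ≃ₗᵢ[ℝ] (EuclideanSpace ℝ (Fin 3))} {V : ℝ → (EuclideanSpace ℝ (Fin 3)) → (EuclideanSpace ℝ (Fin 3))}
    (hS : ∀ t < 0, ∀ x, c • S.symm (V (c ^ 2 * t) (c • S x)) = V t x) :
    ∀ t < 0, ∀ x,
      c ^ 2 • (S.trans S).symm (V ((c ^ 2) ^ 2 * t) (c ^ 2 • (S.trans S) x)) = V t x := by
  intro t ht x
  have hct : c ^ 2 * t < 0 := mul_neg_of_pos_of_neg (by positivity) ht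
  have e1 := hS t ht x
  have e2 := hS (c ^ 2 * t) hct (c • S x)
  rw [← e1, ← e2]
  have h4 : (c ^ 2) ^ 2 * t = c ^ 2 * (c ^ 2 * t) := by ring
  calc c ^ 2 • (S.trans S).symm (V ((c ^ 2) ^ 2 * t) (c ^ 2 • (S.trans S) x))
      = c ^ 2 • S.symm (S.symm (V ((c ^ 2) ^ 2 * t) (c ^ 2 • S (S x)))) := rfl
    _ = c • S.symm (c • S.symm (V (c ^ 2 * (c ^ 2 * t)) (c • S (c • S x)))) := by
        rw [h4, map_smul S, map_smul S.symm, smul_smul, smul_smul, ← sq]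

end Summit.NavierStokesRegularity.NavierStokesRegularity.Theorems.SpatioTemporal

end
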